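import Summits.QuantumFields.QCD.Theorems.GaussianLinkFramesFrameAPrioriBoundLineDefs
import Summits.QuantumFields.QCD.Theorems.GaussianLinkFramesFrameAPrioriBoundStubCubeSmallBall
import Summits.QuantumFields.QCD.Theorems.PauliWegnerSeaTiltedFlatness
import Literature.Analysis.ValidatedNumerics.FixedPointInterval

/-!
# Crux `FrameAPrioriBound` (stmt-QuantumFields-17374), line `cube-cofactor` — stub `stub_tiltTransfer`

THE UNTILT on the two-cube fibre.  For the partial tilt weight
`tiltWt (touches x y) J W = exp Σ_{e touches Q₂(x) ∪ Q₂(y)} Re tr(W_e J_e†)` with `‖(J_e)_{ab}‖ ≤ B`,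
and ANY `F ≥ 0` on configurations with `∫ F dHaar^{⊗E} ≤ M`,
`∫ F · tiltWt dHaar^{⊗E} / ∫ tiltWt dHaar^{⊗E} ≤ C (1 + B)^p M`, with `C, p` absolute.

Proof.  (1) The abstract ball-free untilt `CircleTransport.stub_circleUntilt` of the line
`circle-transport` of crux `TiltedFlatness` (diagonal circle `exists_diagCircle`, Euler word
`stub_eulerWord`) at `n = 10⁴` listed coordinates and Lipschitz constant `K = 9`: a continuous action
`S` reading only listed coordinates and `K`-Lipschitz along every two-sided circle
`s ↦ W[r i ↦ A T(s) B]` has `e^{-βS(W)} / ∫ e^{-βS} ≤ C (1+β)^p`.  (2) The instance: the touched links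
are listed by `SmallBall.exists_listing` (`10⁴` indices, uniformly in `L`), `β := 1 + B`,
`S := -(1+B)⁻¹ Σ_e [touched] Re tr(W_e J_e†)`, so that `e^{-βS} = tiltWt` exactly; `S` is continuous,
reads only touched (hence listed) links, and one summand moves along a circle by
`|Re tr((A (T s − T s') B) J†)| ≤ 9 ‖T s − T s'‖_{op} B ≤ 9 B |s − s'|` (entries are bounded by the
`L²` operator norm, unitaries are isometric multipliers, `s ↦ e^{is}` is `1`-Lipschitz), whence
`K = 9 B/(1+B) ≤ 9`.  (3) `tiltWt / Z ≤ C (2+B)^p ≤ C 2^{p⁺} (1+B)^{p⁺}`.  (4) Assembly: `Z > 0`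
(continuous positive weight, probability measure), `∫ F tiltWt ≤ C' (1+B)^{p⁺} Z ∫ F ≤ C' (1+B)^{p⁺} Z M`
for integrable `F`; a non-integrable `F` has a non-integrable `F · tiltWt` (the weight is continuous and
bounded below on a compact space), so the numerator is `0 ≤ C' (1+B)^{p⁺} M` (`M ≥ ∫ F = 0`).
-/

noncomputable section

namespace Summit.QuantumFields.QCD.Cruxes.FrameAPrioriBound.CubeCofactor

open scoped BigOperators Matrix Matrix.Norms.L2Operator
open MeasureTheory Filter Set Literature.MathematicalPhysics.QuantumFieldTheory
  Literature.MathematicalPhysics.QuantumLattice Literature.Probability.LatticeModels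
open Summit.QuantumFields.QCD.Theorems

namespace TiltTransfer

variable {L : ℕ}

/-! ### Matrix inequalities -/

/-- Entries of a `3 × 3` complex matrix are bounded by its `L²` operator norm. -/
theorem norm_entry_le_l2op (M : Matrix (Fin 3) (Fin 3) ℂ) (a b : Fin 3) : ‖M a b‖ ≤ ‖M‖ := by
  have h := Matrix.l2_opNorm_mulVec M (EuclideanSpace.single b (1 : ℂ))
  rw [PiLp.norm_single, norm_one, mul_one] at h
  refine le_trans ?_ h
  have h2 := PiLp.norm_apply_le
    ((EuclideanSpace.equiv (Fin 3) ℂ).symm (M.mulVec (EuclideanSpace.single b (1 : ℂ)))) a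
  have h3 : ((EuclideanSpace.equiv (Fin 3) ℂ).symm
      (M.mulVec (EuclideanSpace.single b (1 : ℂ)))) a = M a b := by
    rw [PiLp.coe_symm_continuousLinearEquiv, PiLp.toLp_apply, PiLp.ofLp_single,
      Matrix.mulVec_single_one]
    rfl
  rw [h3] at h2
  exact h2

/-- `|Re tr(Δ Jᴴ)| ≤ 9 ‖Δ‖ B` when the entries of `J` are bounded by `B` (`L²` operator norm). -/
theorem abs_re_trace_mul_conjTranspose_le (Δ J : Matrix (Fin 3) (Fin 3) ℂ) {B : ℝ}
    (hJ : ∀ a b, ‖J a b‖ ≤ B) : |(Δ * Jᴴ).trace.re| ≤ 9 * ‖Δ‖ * B := by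
  refine (Complex.abs_re_le_norm _).trans ?_
  simp only [Matrix.trace, Matrix.diag_apply, Matrix.mul_apply, Matrix.conjTranspose_apply]
  calc ‖∑ a, ∑ b, Δ a b * star (J a b)‖ ≤ ∑ a, ‖∑ b, Δ a b * star (J a b)‖ := norm_sum_le _ _
    _ ≤ ∑ a, ∑ b, ‖Δ a b * star (J a b)‖ := Finset.sum_le_sum fun a _ => norm_sum_le _ _
    _ ≤ ∑ _a : Fin 3, ∑ _b : Fin 3, ‖Δ‖ * B := by
        refine Finset.sum_le_sum fun a _ => Finset.sum_le_sum fun b _ => ?_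
        rw [norm_mul, norm_star]
        exact mul_le_mul (norm_entry_le_l2op Δ a b) (hJ a b) (norm_nonneg _) (norm_nonneg _)
    _ = 9 * ‖Δ‖ * B := by
        simp only [Finset.sum_const, Finset.card_univ, Fintype.card_fin]
        ring

/-- One tilt term is `9B`-Lipschitz along the two-sided circle `s ↦ A T(s) B'`: unitaries are
isometric multipliers and the diagonal circle is `1`-Lipschitz in the `L²` operator norm. -/
theorem abs_term_sub_le {T : ℝ → SU3}
    (hT : ∀ θ : ℝ, ((T θ : SU3) : Matrix (Fin 3) (Fin 3) ℂ) =
      Matrix.diagonal ![Complex.exp (θ * Complex.I), Complex.exp (-(θ * Complex.I)), 1])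
    (J : Matrix (Fin 3) (Fin 3) ℂ) {B : ℝ} (hJ : ∀ a b, ‖J a b‖ ≤ B) (A B' : SU3) (s s' : ℝ) :
    |(((A * T s * B' : SU3) : Matrix (Fin 3) (Fin 3) ℂ) * Jᴴ).trace.re -
        (((A * T s' * B' : SU3) : Matrix (Fin 3) (Fin 3) ℂ) * Jᴴ).trace.re| ≤ 9 * B * |s - s'| := by
  rw [← Complex.sub_re, ← Matrix.trace_sub, ← sub_mul]
  refine (abs_re_trace_mul_conjTranspose_le _ J hJ).trans ?_
  have hmul : ((A * T s * B' : SU3) : Matrix (Fin 3) (Fin 3) ℂ) - (A * T s' * B' : SU3) =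
      (A : Matrix (Fin 3) (Fin 3) ℂ) * ((T s : SU3) - (T s' : SU3) : Matrix (Fin 3) (Fin 3) ℂ) *
        (B' : Matrix (Fin 3) (Fin 3) ℂ) := by
    simp only [Submonoid.coe_mul]
    noncomm_ring
  rw [hmul, CStarRing.norm_mul_mem_unitary _ B'.2.1, CStarRing.norm_mem_unitary_mul _ A.2.1]
  -- the diagonal circle is `1`-Lipschitz in the `L²` operator norm (`‖e^{is} - e^{is'}‖ ≤ |s - s'|`,
  -- `Literature…CB.norm_exp_I_sub_exp_I_le`; cf. `CircleTransport.stub_actionLipschitz`)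
  have h : ‖((T s : SU3) : Matrix (Fin 3) (Fin 3) ℂ) - (T s' : SU3)‖ ≤ |s - s'| := by
    rw [hT, hT, Matrix.diagonal_sub, Matrix.l2_opNorm_diagonal]
    refine (pi_norm_le_iff_of_nonneg (abs_nonneg _)).2 fun k => ?_
    fin_cases k
    · simpa using Literature.Analysis.ValidatedNumerics.Numerics.CB.norm_exp_I_sub_exp_I_le s s'
    · have h := Literature.Analysis.ValidatedNumerics.Numerics.CB.norm_exp_I_sub_exp_I_le (-s) (-s')
      rw [show -s - -s' = -(s - s') by ring, abs_neg] at h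
      simpa using h
    · simp
  have hB : 0 ≤ B := (norm_nonneg _).trans (hJ 0 0)
  calc 9 * ‖((T s : SU3) : Matrix (Fin 3) (Fin 3) ℂ) - (T s' : SU3)‖ * B
      = 9 * B * ‖((T s : SU3) : Matrix (Fin 3) (Fin 3) ℂ) - (T s' : SU3)‖ := by ring
    _ ≤ 9 * B * |s - s'| := mul_le_mul_of_nonneg_left h (by positivity)

/-! ### The tilt exponent: continuity -/

/-- One tilt term `W ↦ Re tr(W_e Jᴴ)` is continuous. -/
theorem continuous_term (e : Edge 4 L) (J : Matrix (Fin 3) (Fin 3) ℂ) :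
    Continuous fun W : GaugeConfig 4 L SU3 =>
      (((W e : SU3) : Matrix (Fin 3) (Fin 3) ℂ) * Jᴴ).trace.re :=
  Complex.continuous_re.comp
    (((continuous_subtype_val.comp (continuous_apply e)).matrix_mul continuous_const).matrix_trace)

variable [NeZero L]

/-- The tilt exponent `W ↦ Σ_{e ∈ S} Re tr(W_e J_e†)` is continuous. -/
theorem continuous_exponent (S : Edge 4 L → Bool) (J : Edge 4 L → Matrix (Fin 3) (Fin 3) ℂ) :
    Continuous fun W : GaugeConfig 4 L SU3 =>
      ∑ e : Edge 4 L, if S e then (((W e : SU3) : Matrix (Fin 3) (Fin 3) ℂ) * (J e)ᴴ).trace.re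
        else 0 := by
  refine continuous_finsetSum _ fun e _ => ?_
  by_cases he : S e = true
  · simp only [he, ↓reduceIte]
    exact continuous_term e (J e)
  · simp only [he, Bool.false_eq_true, ↓reduceIte]
    exact continuous_const

/-- The partial tilt weight is continuous. -/
theorem continuous_tiltWt (S : Edge 4 L → Bool) (J : Edge 4 L → Matrix (Fin 3) (Fin 3) ℂ) :
    Continuous (tiltWt S J : GaugeConfig 4 L SU3 → ℝ) :=
  Real.continuous_exp.comp (continuous_exponent S J)

/-! ### The density bound from the abstract untilt -/

/-- The density bound `tiltWt / Z ≤ C (2 + B)^p` for the partial tilt weight, from the abstract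
untilt at `n = 10⁴` listed coordinates and Lipschitz constant `9`, applied to the action
`S = -(1+B)⁻¹ Σ_{e touched} Re tr(W_e J_e†)` and `β = 1 + B`. -/
theorem density_le {T : ℝ → SU3}
    (hT : ∀ θ : ℝ, ((T θ : SU3) : Matrix (Fin 3) (Fin 3) ℂ) =
      Matrix.diagonal ![Complex.exp (θ * Complex.I), Complex.exp (-(θ * Complex.I)), 1])
    {C p : ℝ}
    (hD : ∀ (E : Type) [Fintype E] [DecidableEq E] (ι : Type) [Fintype ι] (r : ι → E),
      Fintype.card ι ≤ 10000 →
      ∀ S : (E → SU3) → ℝ, Continuous S →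
        (∀ W W' : E → SU3, (∀ i, W (r i) = W' (r i)) → S W = S W') →
        (∀ (W : E → SU3) (i : ι) (A B : SU3) (s s' : ℝ),
          |S (Function.update W (r i) (A * T s * B)) -
              S (Function.update W (r i) (A * T s' * B))| ≤ 9 * |s - s'|) →
        ∀ β : ℝ, 0 ≤ β → ∀ W : E → SU3,
          Real.exp (-(β * S W)) /
              (∫ W', Real.exp (-(β * S W')) ∂(Measure.pi fun _ : E => haarProbability SU3)) ≤
            C * (1 + β) ^ p)
    (x y : TorusSite 4 L) {B : ℝ} (hB : 0 ≤ B) (J : Edge 4 L → Matrix (Fin 3) (Fin 3) ℂ)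
    (hJ : ∀ e i j, ‖J e i j‖ ≤ B) (W : GaugeConfig 4 L SU3) :
    tiltWt (touches x y) J W / (∫ W', tiltWt (touches x y) J W' ∂(haarPi L)) ≤
      C * (2 + B) ^ p := by
  obtain ⟨r, hcover⟩ := SmallBall.exists_listing x y
  have h1B : (0 : ℝ) < 1 + B := by linarith
  -- the exponent and the action
  set Sg : GaugeConfig 4 L SU3 → ℝ := fun W => ∑ e : Edge 4 L,
    if touches x y e then (((W e : SU3) : Matrix (Fin 3) (Fin 3) ℂ) * (J e)ᴴ).trace.re else 0
    with hSg
  set S : GaugeConfig 4 L SU3 → ℝ := fun W => -((1 + B)⁻¹ * Sg W) with hS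
  have key : ∀ W, Real.exp (-((1 + B) * S W)) = tiltWt (touches x y) J W := by
    intro W
    show Real.exp (-((1 + B) * S W)) = Real.exp (Sg W)
    simp only [hS, mul_neg, neg_neg, ← mul_assoc, mul_inv_cancel₀ h1B.ne', one_mul]
  have hSgc : Continuous Sg := by
    rw [hSg]
    exact continuous_exponent (touches x y) J
  have hSc : Continuous S := by
    rw [hS]
    exact (continuous_const.mul hSgc).neg
  -- the action reads only listed links
  have hdep : ∀ W W' : GaugeConfig 4 L SU3, (∀ i, W (r i) = W' (r i)) → S W = S W' := by
    intro W W' h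
    have hg : Sg W = Sg W' := by
      simp only [hSg]
      refine Finset.sum_congr rfl fun e _ => ?_
      by_cases he : touches x y e = true
      · obtain ⟨i, rfl⟩ := hcover e he
        rw [h i]
      · simp only [he, Bool.false_eq_true, ↓reduceIte]
    simp only [hS, hg]
  -- the exponent is `9B`-Lipschitz along circles at a listed link
  have hlipSg : ∀ (W : GaugeConfig 4 L SU3) (i : (Bool × Bool) × (Fin 4 → Fin 5) × Fin 4)
      (A B' : SU3) (s s' : ℝ),
      |Sg (Function.update W (r i) (A * T s * B')) - Sg (Function.update W (r i) (A * T s' * B'))| ≤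
        9 * B * |s - s'| := by
    intro W i A B' s s'
    have hdiff : Sg (Function.update W (r i) (A * T s * B')) -
        Sg (Function.update W (r i) (A * T s' * B')) =
        if touches x y (r i) then
          (((A * T s * B' : SU3) : Matrix (Fin 3) (Fin 3) ℂ) * (J (r i))ᴴ).trace.re -
            (((A * T s' * B' : SU3) : Matrix (Fin 3) (Fin 3) ℂ) * (J (r i))ᴴ).trace.re
        else 0 := by
      simp only [hSg]
      rw [← Finset.sum_sub_distrib, Finset.sum_eq_single (r i)]
      · simp only [Function.update_self]
        split_ifs <;> simp
      · intro e _ hne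
        rw [Function.update_of_ne hne, Function.update_of_ne hne, sub_self]
      · intro h
        exact absurd (Finset.mem_univ _) h
    rw [hdiff]
    split_ifs
    · exact abs_term_sub_le hT (J (r i)) (hJ (r i)) A B' s s'
    · rw [abs_zero]
      positivity
  have hlip : ∀ (W : GaugeConfig 4 L SU3) (i : (Bool × Bool) × (Fin 4 → Fin 5) × Fin 4)
      (A B' : SU3) (s s' : ℝ),
      |S (Function.update W (r i) (A * T s * B')) - S (Function.update W (r i) (A * T s' * B'))| ≤
        9 * |s - s'| := by
    intro W i A B' s s'
    have h := hlipSg W i A B' s s'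
    have e1 : S (Function.update W (r i) (A * T s * B')) -
        S (Function.update W (r i) (A * T s' * B')) =
        -(1 + B)⁻¹ * (Sg (Function.update W (r i) (A * T s * B')) -
          Sg (Function.update W (r i) (A * T s' * B'))) := by
      simp only [hS]
      ring
    rw [e1, abs_mul, abs_neg, abs_of_pos (inv_pos.2 h1B), inv_mul_le_iff₀ h1B]
    nlinarith [abs_nonneg (s - s'), hB]
  have h := hD (Edge 4 L) ((Bool × Bool) × (Fin 4 → Fin 5) × Fin 4) r (by simp) S hSc hdep hlip
    (1 + B) h1B.le W
  rw [show (1 : ℝ) + (1 + B) = 2 + B by ring] at h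
  simp only [key] at h
  exact h

end TiltTransfer

open TiltTransfer in
/-- STUB `tiltTransfer` (THE UNTILT on the two-cube fibre).  There are absolute `C > 0`, `p` such
that for every torus `L ≥ 4`, sites `x, y`, bound `B ≥ 0`, sources `J` with entries of norm `≤ B`,
and every `F ≥ 0` on configurations with `∫ F dHaar^{⊗E} ≤ M`: the tilted mean of `F` with the
partial tilt weight `tiltWt (touches x y) J` is at most `C (1 + B)^p M`. -/
theorem stub_tiltTransfer : ∃ C p : ℝ, 0 < C ∧ ∀ (L : ℕ) [NeZero L], 4 ≤ L →
    ∀ (x y : TorusSite 4 L) (B : ℝ), 0 ≤ B →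
    ∀ J : Edge 4 L → Matrix (Fin 3) (Fin 3) ℂ, (∀ e i j, ‖J e i j‖ ≤ B) →
    ∀ (F : GaugeConfig 4 L SU3 → ℝ), (∀ W, 0 ≤ F W) → ∀ M : ℝ,
    ∫ W, F W ∂(haarPi L) ≤ M →
    (∫ W, F W * tiltWt (touches x y) J W ∂(haarPi L)) /
        (∫ W, tiltWt (touches x y) J W ∂(haarPi L)) ≤ C * (1 + B) ^ p * M := by
  obtain ⟨T, hT⟩ := CircleTransport.exists_diagCircle
  obtain ⟨C, p, hC, hD⟩ :=
    CircleTransport.stub_circleUntilt T hT (CircleTransport.stub_eulerWord T hT) 10000 9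
  refine ⟨C * 2 ^ max p 0, max p 0, by positivity, ?_⟩
  intro L _ _hL x y B hB J hJ F hF0 M hM
  set μ : Measure (GaugeConfig 4 L SU3) := haarPi L with hμ
  set wt : GaugeConfig 4 L SU3 → ℝ := tiltWt (touches x y) J with hwt
  set Z : ℝ := ∫ W, wt W ∂μ with hZdef
  haveI : IsProbabilityMeasure μ := by
    rw [hμ]
    dsimp only [haarPi]
    infer_instance
  -- the weight: continuous, positive, positive mass
  have hwtc : Continuous wt := by
    rw [hwt]
    exact continuous_tiltWt (touches x y) J
  have hwt0 : ∀ W, 0 < wt W := fun W => Real.exp_pos _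
  have hZ : 0 < Z := by
    obtain ⟨Wm, -, hWm⟩ := isCompact_univ.exists_isMinOn univ_nonempty hwtc.continuousOn
    have hle : ∫ _W, wt Wm ∂μ ≤ Z :=
      integral_mono (integrable_const _) (TiltedFlatnessNegative.integrable_of_continuous hwtc)
        fun W => hWm (mem_univ W)
    have hc' : ∫ _W, wt Wm ∂μ = wt Wm := by simp
    linarith [hwt0 Wm]
  have hM0 : 0 ≤ M := (integral_nonneg fun W => hF0 W).trans hM
  -- the pointwise density bound
  have h2B : (1 : ℝ) ≤ 2 + B := by linarith
  have hcmp : C * (2 + B) ^ p ≤ C * 2 ^ max p 0 * (1 + B) ^ max p 0 := by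
    calc C * (2 + B) ^ p ≤ C * (2 + B) ^ max p 0 :=
          mul_le_mul_of_nonneg_left (Real.rpow_le_rpow_of_exponent_le h2B (le_max_left _ _)) hC.le
      _ ≤ C * (2 * (1 + B)) ^ max p 0 :=
          mul_le_mul_of_nonneg_left
            (Real.rpow_le_rpow (by linarith) (by linarith) (le_max_right _ _)) hC.le
      _ = C * 2 ^ max p 0 * (1 + B) ^ max p 0 := by
          rw [Real.mul_rpow (by norm_num) (by linarith), mul_assoc]
  have hdens : ∀ W, wt W ≤ C * 2 ^ max p 0 * (1 + B) ^ max p 0 * Z := by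
    intro W
    have h : wt W / Z ≤ C * (2 + B) ^ p := density_le hT hD x y hB J hJ W
    exact (div_le_iff₀ hZ).1 (h.trans hcmp)
  have hK0 : 0 ≤ C * 2 ^ max p 0 * (1 + B) ^ max p 0 := by positivity
  -- the numerator
  have hnum : ∫ W, F W * wt W ∂μ ≤ C * 2 ^ max p 0 * (1 + B) ^ max p 0 * Z * M := by
    by_cases hFi : Integrable F μ
    · calc ∫ W, F W * wt W ∂μ
          ≤ ∫ W, C * 2 ^ max p 0 * (1 + B) ^ max p 0 * Z * F W ∂μ :=
            integral_mono_of_nonneg (ae_of_all _ fun W => mul_nonneg (hF0 W) (hwt0 W).le)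
              (hFi.const_mul _) (ae_of_all _ fun W => by
                calc F W * wt W ≤ F W * (C * 2 ^ max p 0 * (1 + B) ^ max p 0 * Z) :=
                      mul_le_mul_of_nonneg_left (hdens W) (hF0 W)
                  _ = C * 2 ^ max p 0 * (1 + B) ^ max p 0 * Z * F W := by ring)
        _ = C * 2 ^ max p 0 * (1 + B) ^ max p 0 * Z * ∫ W, F W ∂μ := integral_const_mul _ _
        _ ≤ C * 2 ^ max p 0 * (1 + B) ^ max p 0 * Z * M :=
            mul_le_mul_of_nonneg_left hM (mul_nonneg hK0 hZ.le)
    · have hFwt : ¬Integrable (fun W => F W * wt W) μ := by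
        intro h
        apply hFi
        have hinvc : Continuous fun W => (wt W)⁻¹ := hwtc.inv₀ fun W => (hwt0 W).ne'
        obtain ⟨c, hc⟩ := isCompact_univ.exists_bound_of_continuousOn hinvc.continuousOn
        have h2 : Integrable (fun W => F W * wt W * (wt W)⁻¹) μ :=
          h.mul_bdd hinvc.aestronglyMeasurable (ae_of_all _ fun W => hc W (mem_univ W))
        have heq : ∀ W, F W * wt W * (wt W)⁻¹ = F W := fun W => by
          rw [mul_assoc, mul_inv_cancel₀ (hwt0 W).ne', mul_one]
        simp only [heq] at h2
        exact h2
      rw [integral_undef hFwt]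
      exact mul_nonneg (mul_nonneg hK0 hZ.le) hM0
  -- conclusion
  rw [div_le_iff₀ hZ]
  calc ∫ W, F W * wt W ∂μ ≤ C * 2 ^ max p 0 * (1 + B) ^ max p 0 * Z * M := hnum
    _ = C * 2 ^ max p 0 * (1 + B) ^ max p 0 * M * Z := by ring

end Summit.QuantumFields.QCD.Cruxes.FrameAPrioriBound.CubeCofactor

end
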